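/-
Copyright (c) 2026 the pub-hodgecm-mathlib formalisation cell (harness21).  Assembler seat hodgecm-mathlib-LH4-p01 (g17) (heir LEAD F0P3a-plan T17-31 (R-9): «U0 = LH4-p01
lineage»), dealer LH4-plan (g10) WORD #8 (6), desk F0P3-plan (g21) TIER-1 INVENTORY v1 56a02b7f4f575bad §U0.  2026-09-03.
-/
import Summits.HodgeConjecture.HodgeConjecture.Theorems.F0P3cDyRamWildTransitivity        -- ★ LH4-p02 (g12): `wildTransitivity_holds`, `htr₂_of_isRamifiedQuadraticDatum`; brings ★ №1 law-defs leaf (`WildTreeAt`, `WildTree`, `IsRamifiedQuadraticDatum`) and ★ p854568 (htr₀-WILD)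
import Summits.HodgeConjecture.HodgeConjecture.Theorems.F0P3cDyRamWildTreeOfTransitivity   -- ★ B-p04 (g61): `isTree_latticeGraph_three_of_transitive_valued`, `wildTree_of_wildTransitivity`
import Literature.NumberTheory.Automorphic.UnitaryLatticeTreePeriodRelationRamified       -- ★ the tame-ramified (E)∕(N) relations (tokens `glInt`, `fixedBy`, `orbitRel`, flags); brings ★ `…EulerRelationRamified`, ★ `…ValencyRamified`, ★ `…LevelIndices`
import Summits.HodgeConjecture.HodgeConjecture.Theorems.F0P3cDyRamU0DatumUnique          -- ★ p854647 (this seat): `d_t_unique` (the datum is uniformiser-free) — pays the desk row `stub_U0_d_t_unique`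
import Summits.HodgeConjecture.HodgeConjecture.Theorems.F0P3cDyRamFourFramePieces       -- ★ DEFS №3 (dealer; filed by LH4-p03): `dOfPlace L v w` (the intrinsic different number; its identification is `stub_U0_dOfPlace_eq`)
import Literature.NumberTheory.Automorphic.UnitaryLatticeTreeRootStarOrbitWild           -- ★ p854659 (this seat): `flagTransitive_of_isRamifiedQuadraticDatum` — pays the row `stub_U0_flagTransitive_wild` (edge transitivity at the wild datum)
import Literature.NumberTheory.Automorphic.UnitaryLatticeTreeEulerRelationWild           -- ★ p854681 (this seat): `fixedSet_subtree_of_isRamifiedQuadraticDatum` — PAYS `stub_U0_fixedSet_subtree` (Kottwitz's Euler relation at the wild datum)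
import Literature.NumberTheory.Automorphic.UnitaryLatticeTreePeriodRelationWild          -- ★ p854692 (this seat): `period_relation_of_isRamifiedQuadraticDatum` — PAYS `stub_U0_period_relation_wild`
import Literature.NumberTheory.Automorphic.UnitaryLatticeTreeTypeTwoStarCountWild        -- ★ p854683 (LH4-p02 (g12)): `ncard_neighborSet_of_isVertexLattice_two_of_isRamifiedQuadraticDatum` — PAYS `stub_U0_valency_typeTwo_wild`
import Literature.NumberTheory.Automorphic.UnitaryLatticeTreeRootStarCountWild           -- ★ p854714 (LH4-p02 (g12)): `ncard_neighborSet_of_isSelfDualLattice_of_isRamifiedQuadraticDatum` — PAYS `stub_U0_valency_typeZero_wild`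
import Literature.NumberTheory.Automorphic.UnitaryLatticeTreeLevelIndicesWild            -- ★ p854731 (this seat): `index_inf_subgroupOf_eq_of_isRamifiedQuadraticDatum` — PAYS `stub_U0_iwahoriIndex_wild`
import Literature.NumberTheory.LocalFields.WildQuadraticDatumNormSurjective               -- ★ p854729 (LH4-p02 (g12)): `exists_mul_map_eq_of_isRamifiedQuadraticDatum` — PAYS `stub_U0_normSurj_oneUnits_wild` (Serre V §3 Cor. 3, sharp `ψ`)
import Summits.HodgeConjecture.HodgeConjecture.Theorems.F0P3cDyRamDOfPlaceOfDatum       -- ★ p854662 (LH4-p02 (g12)): `dOfPlace_eq_of_isRamifiedQuadraticDatum` — PAYS `stub_U0_dOfPlace_eq`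
import HarnessLib

/-!
# Crux `H413`, line «(D-RAM) FOUR-FRAME» `Cruxes/H413/Lines/F0_P3c_DyRamFourFrame.lean` — TIER-1 SOCKET MODULE `U0_WildTree` (unit (ii-0): the WILD LATTICE TREE of
# `(K³, Φ₃)` at a ramified quadratic datum — tree-ness, valencies, spheres, edge transitivity, Iwahori indices, Euler ∕ period relations, level norms, datum intrinsicality), v6 — ALL SEVEN REGISTERED STUBS PAID (0 `sorry`)

Cell `hodgecm-mathlib` (D-0151), FLOOR 0, crux item H413 = `stmt-HodgeConjecture-24833`, route of record `HCCMUnconditional`; Track A (heir LEAD T17-31 (R-8)–(R-11), director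
s1812; dealer LH4-plan (g10) WORD #8 (6); desk INVENTORY-TIER1 v1 56a02b7f4f575bad §U0: «U0_WildTree = 11 stubs (9–13 after the assembler's cut), files 13–27»).  A TIER-1 MODULE
(LEAD (R-9)): every PLANNED theorem of the unit as `theorem stub_U0_<name> : ‹statement over ★ DEFS names› := by sorry` + SORRY-FREE exports concluding BY NAME what the unit
feeds to its consumers (U1's A-2↓ `Reachable`, U2G's census dictionaries, the line's `WildTree`); sorries ONLY in `stub_*` ((R-10)(e)); every stub binds the datum
`IsRamifiedQuadraticDatum σ ϖ d t` ((R-10)(a)); registered BY WRITE only (s1809 (3)) by a writer seat (this assembler has `write_cruxes: []`); REF1 by-name box + ref4∕LHref-N∕LH-ref2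
VACUITY PASS before «LANDED n» is said for it ((R-10)(g)).
HONEST LABEL: HC_CM is proved only modulo the 7 printed citations (2 remaining: hLiu418 = stmt-HodgeConjecture-24832, h413 = stmt-HodgeConjecture-24833) until rung 0 closes;
since v6 every `stub_*` below is a PROVED theorem line (the module is sorry-free, axioms TRIO) — it closes unit (ii-0)'s registered debt ONLY; tier 0's six stubs and h413 stay
OPEN, nothing printed is asserted; the verdict of record for (D-RAM) stays PRINT [LanglandsShelstad1989 Thm. p. 484 ∕ Rogawski1990 Prop. 4.9.1 (a)] ∕ XL.

PAID ★ (imported, cited BY NAME in §0; NOT re-stubbed): htr₀-WILD ★ `exists_unitary_mapGL_stdLattice_eq_of_isSelfDualLattice_of_ramified` (p854568), htr₂-WILD ★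
`forall_isVertexLattice_two_exists_mapGL_N₁_eq_of_ramified` ∕ `htr₂_of_isRamifiedQuadraticDatum` (p854567 ∕ p854569 ∕ p854580), the tree from transitivity ★
`isTree_latticeGraph_three_of_transitive_valued` ∕ `wildTree_of_wildTransitivity` (p854579), `wildTransitivity_holds` (p854580), the CM-place dress ★ p854598, the (D-G)
t = 0 dictionary ★ p854635, the datum arithmetic ★ `WildQuadraticDatumTrace` (p854561).

§0 SORRY-FREE EXPORTS (what U0 hands upward NOW): `isTree_of_isRamifiedQuadraticDatum` (the wild tree UNFENCED — no `|2| < 1`, no completeness: `[Finite 𝓀[K]]` + the datum),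
`connected_of_isRamifiedQuadraticDatum`, `reachable_of_isRamifiedQuadraticDatum` (desk row `stub_U0_reachable_of_wildTree` — U1's A-2↓ `Reachable` hypothesis, GLUE, paid here),
`wildTree_holds : WildTree` (the line's (ii-0) Prop BY NAME), `d_t_unique_wild` (desk row `stub_U0_d_t_unique`, PAID by ★ p854647 `d_t_unique`), `flagTransitive_wild` (row
`stub_U0_flagTransitive_wild`, PAID by ★ p854659 `flagTransitive_of_isRamifiedQuadraticDatum`: EDGE TRANSITIVITY at the wild datum).
§1 STUBS v6 — ALL SEVEN REGISTERED `stub_U0_*` ARE PAID at tier 2 and kept UNDER THEIR STUB NAMES AS THEOREM LINES (no `sorry` anywhere in the module; the U1 pattern, dealer WORD #15):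
`stub_U0_normSurj_oneUnits_wild` ← ★ p854729 (LH4-p02; completeness binder RE-BOUND in v6, see the stub), `stub_U0_valency_typeZero_wild` ← ★ p854714 (LH4-p02),
`stub_U0_valency_typeTwo_wild` ← ★ p854683 (LH4-p02), `stub_U0_dOfPlace_eq` ← ★ p854662 (LH4-p02), `stub_U0_iwahoriIndex_wild` ← ★ p854731 (this seat), `stub_U0_fixedSet_subtree` ← ★ p854681
(this seat), `stub_U0_period_relation_wild` ← ★ p854692 (this seat) + §2 ONE IN-MODULE ASSEMBLY (`sphere_card_wild`, the desk row `stub_U0_sphere_card_wild` DERIVED from the two valency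
lines and §0's tree — sorry-free, axioms TRIO; (R-9) «assembly theorems showing the unit's stubs ⟹ what they feed»).  The rows, as planned:
* `stub_U0_normSurj_oneUnits_wild` — the `hnorm` REPLACEMENT (LEVEL NORMS): `σ`-fixed one-units of level `≥ 2d` (`E`-normalised; = conductor `d` over `F`) are norms
  `z·σz` with `|z − 1|·|ϖ|^d ≤ |u − 1|·|ϖ|` (the clause shape of ★ `ramifiedBlock_adicCompletion_of_ramified`, true at every ramified CM place; abstractly: Hensel ∕ ★ norm ladder).
* `stub_U0_valency_typeZero_wild`, `stub_U0_valency_typeTwo_wild` — `#star(v) = q + 1` at BOTH vertex types (CENSUS-SHAPED: engine `q+1, q+1`; the local index `(q+1, q+1)` of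
  the ramified quasi-split `U(3)`, both vertices special; at `|2| < 1` the residual conic of the type-0 star degenerates to the double line `x₁² = 0` — still `q + 1` points).
* `stub_U0_dOfPlace_eq` — `IsRamifiedQuadraticDatum σ_w ϖ d t → dOfPlace L v w = d` at a ramified CM place (dealer WORD #10 (1)(d) ∕ LEAD T17-34 (b6): the condition
  under which the intrinsic `sInf` of ★ №3 is accepted; two lines over ★ #12 + ★ p854647's residual depth — LH4-p02's `dOfPlace_eq_of_isRamifiedQuadraticDatum`, head shape agreed).
* `stub_U0_iwahoriIndex_wild` — `[K₀ : K₀ ⊓ K₁] = q + 1 = [K₁ : K₀ ⊓ K₁]` (desk row `levelIndex`: the part of it that is a tree statement; the Haar masses of deeper congruence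
  levels are U2G's `stub_U2G_measure_normalisation` — the (D-G) t = 0 constant is `νG₃(K₀)` by ★ p854635 and needs no index).
* `stub_U0_fixedSet_subtree` — Kottwitz's EULER relation `#Fix_γ(U∕K₀) + #Fix_γ(U∕K₁) = #Fix_γ(U∕(K₀ ⊓ K₁)) + 1` ((K-1)(c): `n₀ + n₂ = e + 1`, the fixed set is a finite subtree; the
  conclusion of ★ `natCard_fixedBy_add_eq_natCard_fixedBy_inf_add_one_three_of_neg` TOKEN FOR TOKEN).
* `stub_U0_period_relation_wild` — Kottwitz's NON-ELLIPTIC relation (the conclusion of ★ `natCard_quotient_fixedBy_add_eq_natCard_quotient_fixedBy_inf_three_of_neg` TOKEN FOR TOKEN).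
NOT IN v1 (typed in v2 on U2G's demand, desk §U0 note «only what U2G's dictionary stubs import»): the horosphere transversals (H5)∕(H6) (★ `HorosphereTransversalRamified`) and the
horocycle type-two star counts (★ `HorocycleTypeTwoStarRamified`) at the wild datum — their odd-depth clauses want the unit analysis at `|2| < 1` first (desk label), so they
are typed when U2G names the rows it imports (+1 stub each, announced on the bus).
INSTANCE BINDERS: the Iwahori ∕ Euler ∕ period rows speak ★ `glInt 3 K` (the `ValuativeRel` spelling of `GL₃(𝒪)`), so they bind `[ValuativeRel K] [(Valued.v).Compatible]` as the ★
files do; at a CM place both instances exist, at an abstract `Valued` datum a consumer installs them by `ValuativeRel.ofValuation` (★ `isTree_latticeGraph_three_of_transitive_valued`).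

## References (print anchors of the unit; nothing asserted here)
* [BruhatTits1972] F. Bruhat, J. Tits, *Groupes réductifs sur un corps local I*, Publ. Math. IHÉS 41 (1972), §10 (lattice models; vertex stabilisers; one orbit per special type).
* [Tits1979] J. Tits, *Reductive groups over local fields*, PSPM 33.1 (1979), §2.7 (p. 48), §2.10 (p. 49) (rank-one groups: the building is a tree; the `SU₃` examples).
* [Serre1980Trees] J.-P. Serre, *Trees* (1980), Ch. I §2.3, §6.1, §6.4; Ch. II §1.1.
* [Kottwitz1988] R. E. Kottwitz, *Tamagawa numbers*, Ann. of Math. 127 (1988), §2 Theorem 2 (Euler–Poincaré functions: the elliptic and non-elliptic relations).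
* [Serre1979] J.-P. Serre, *Local Fields* (1979), Ch. V §3 (norms of one-units in a totally ramified cyclic extension), Ch. III §6 Prop. 13 (the different).
* [Jacobowitz1962] R. Jacobowitz, *Hermitian forms over local fields*, Amer. J. Math. 84 (1962), §§9–11 (ramified dyadic lattices).
-/

set_option autoImplicit false

noncomputable section

namespace Summit.HodgeConjecture.HodgeConjecture.Cruxes.H413.F0P3cDyRamFourFrameU0

open Matrix MulAction SimpleGraph
open Literature.NumberTheory.Automorphic Literature.NumberTheory.Automorphic.HermitianLattice Literature.NumberTheory.Automorphic.UnitaryLatticeTree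
open Literature.NumberTheory.Automorphic.UnitaryThreeFourFrame
open Summit.HodgeConjecture.HodgeConjecture.Cruxes.H413.F0P3cDyRamFourFrameLawDefs
open Summit.HodgeConjecture.HodgeConjecture.Cruxes.H413.F0P3cDyRamWildTransitivity
open Summit.HodgeConjecture.HodgeConjecture.Cruxes.H413.F0P3cDyRamWildTreeOfTransitivity
open Literature.NumberTheory.Automorphic.UnitaryGroup NumberField IsDedekindDomain
open scoped Matrix MatrixGroups WithZero Valued

/-! ## §0  Sorry-free exports: the wild tree UNFENCED, connectedness, reachability, `WildTree` -/

/-- **THE WILD LATTICE GRAPH IS A TREE, UNFENCED**: at every ramified quadratic datum with finite residue field — no `|2| < 1`, no completeness — the lattice graph of `(K³, Φ₃)` is a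
tree (htr₀-WILD ★ p854568 + htr₂-WILD ★ `htr₂_of_isRamifiedQuadraticDatum` into ★ `isTree_latticeGraph_three_of_transitive_valued`). [cite: BruhatTits1972, §10] [cite: Tits1979, §2.7 (p. 48)] -/
theorem isTree_of_isRamifiedQuadraticDatum {K : Type} [Field K] [Valued K ℤᵐ⁰] [Finite 𝓀[K]] {σ : K →+* K} {ϖ : K} {d t : ℕ}
    (hD : IsRamifiedQuadraticDatum σ ϖ d t) : (latticeGraph σ ϖ ((StdForm.antidiagonal 3).over K)).IsTree :=
  isTree_latticeGraph_three_of_transitive_valued hD.1 hD.2.1 hD.2.2.1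
    (exists_unitary_mapGL_stdLattice_eq_of_isSelfDualLattice_of_ramified hD.1 hD.2.1 hD.2.2.1 hD.2.2.2.1 hD.2.2.2.2.1 hD.2.2.2.2.2.1 hD.2.2.2.2.2.2)
    (htr₂_of_isRamifiedQuadraticDatum hD)

/-- **The wild lattice graph is CONNECTED** (desk row `stub_U0_reachable_of_wildTree`, GLUE — paid). [cite: Serre1980Trees, II.1.1] -/
theorem connected_of_isRamifiedQuadraticDatum {K : Type} [Field K] [Valued K ℤᵐ⁰] [Finite 𝓀[K]] {σ : K →+* K} {ϖ : K} {d t : ℕ}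
    (hD : IsRamifiedQuadraticDatum σ ϖ d t) : (latticeGraph σ ϖ ((StdForm.antidiagonal 3).over K)).Connected :=
  (isTree_of_isRamifiedQuadraticDatum hD).connected

/-- **Any two vertices of the wild lattice graph are joined by a path** — the `Reachable` hypothesis of U1's A-2↓ (★ `UnitaryThreeFourFrame.AxisExponentEqTreeDistance` with the
explicit `Connected` antecedent, T17-26 (r1)). [cite: Serre1980Trees, II.1.1] -/
theorem reachable_of_isRamifiedQuadraticDatum {K : Type} [Field K] [Valued K ℤᵐ⁰] [Finite 𝓀[K]] {σ : K →+* K} {ϖ : K} {d t : ℕ}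
    (hD : IsRamifiedQuadraticDatum σ ϖ d t)
    (u v : {M : Submodule 𝒪[K] (Fin 3 → K) // IsVertex σ ϖ ((StdForm.antidiagonal 3).over K) M}) :
    (latticeGraph σ ϖ ((StdForm.antidiagonal 3).over K)).Reachable u v :=
  (connected_of_isRamifiedQuadraticDatum hD).preconnected u v

/-- **The line's (ii-0) Prop `WildTree` HOLDS** (★ `wildTree_of_wildTransitivity` ∘ ★ `wildTransitivity_holds`; re-exported here so the unit's consumers import ONE module). [cite: BruhatTits1972, §10] -/
theorem wildTree_holds : WildTree := wildTree_of_wildTransitivity wildTransitivity_holds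

/-- **THE DATUM IS INTRINSIC** (desk row `stub_U0_d_t_unique`, PAID): `d`, `t` of `IsRamifiedQuadraticDatum σ ϖ d t` do not depend on the uniformiser — ★ p854647 `d_t_unique`
(dealer #12 clause; ref4 R4-71 (T1)). [cite: Serre1979, Ch. III §6 Prop. 13] -/
theorem d_t_unique_wild {K : Type} [Field K] [Valued K ℤᵐ⁰] (σ : K →+* K) (ϖ ϖ' : K) (d t d' t' : ℕ)
    (hD : IsRamifiedQuadraticDatum σ ϖ d t) (hD' : IsRamifiedQuadraticDatum σ ϖ' d' t') : d = d' ∧ t = t' :=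
  F0P3cDyRamU0DatumUnique.d_t_unique σ ϖ ϖ' d t d' t' hD hD'

/-- **EDGE TRANSITIVITY OF THE WILD TREE** (desk∕assembler row `stub_U0_flagTransitive_wild`, PAID by ★ p854659): every flag `M < L` (`L` self-dual, `M` of type two) is
`(u·𝒪³ ⊃ u·N₁)`, `N₁ = g₁·𝒪³`, `g₁ = diag(1,1,ϖ)` — the (I)-input of the Euler ∕ period rows. [cite: BruhatTits1972, §10] [cite: Tits1979, §2.7 (p. 48)] -/
theorem flagTransitive_wild {K : Type} [Field K] [Valued K ℤᵐ⁰] [CompleteSpace K] [Fintype 𝓀[K]] (σ : K →+* K) (ϖ : K) (d t : ℕ) (hD : IsRamifiedQuadraticDatum σ ϖ d t)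
    (g₁ : GL (Fin 3) K) (hg₁ : (g₁ : Matrix (Fin 3) (Fin 3) K) = Matrix.diagonal ![(1 : K), 1, ϖ])
    (L M : Submodule 𝒪[K] (Fin 3 → K)) (hL : IsSelfDualLattice σ ϖ ((StdForm.antidiagonal 3).over K) L)
    (hM : IsVertexLattice σ ϖ ((StdForm.antidiagonal 3).over K) 2 M) (hlt : M < L) :
    ∃ u : ↥(unitaryGroupOfForm σ ((StdForm.antidiagonal 3).over K)),
      mapGL (u : GL (Fin 3) K) (stdLattice K 3) = L ∧ mapGL ((u : GL (Fin 3) K) * g₁) (stdLattice K 3) = M :=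
  flagTransitive_of_isRamifiedQuadraticDatum σ ϖ d t hD g₁ hg₁ L M hL hM hlt

/-! ## §1  The unit's seven registered stubs, ALL PAID: theorem lines under their stub names, each binding the datum (no `sorry`) -/

/-- **`stub_U0_normSurj_oneUnits_wild` — LEVEL NORMS (the `hnorm` replacement at a wild place).**  At a ramified quadratic datum over a field whose valuation ring is `𝓂`-adically
complete, every `σ`-fixed `u` with `|u − 1| ≤ |ϖ|^{2d}` (`E`-level `2d` = `F`-level `d` = the conductor) is a norm `z·σz` with `|z − 1|·|ϖ|^d ≤ |u − 1|·|ϖ|` — the clause of ★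
`ramifiedBlock_adicCompletion_of_ramified` (true at every ramified CM place); Serre's `N(U_E^{ψ(n)}) = U_F^{n}`, `ψ(n) = 2n − d + 1`, for `n ≥ d`, on the nose.  PAID at tier 2 by ★ p854729
`Literature.NumberTheory.LocalFields.WildQuadraticDatum.exists_mul_map_eq_of_isRamifiedQuadraticDatum` (LH4-p02 (g12): trace-one element `θ` with `|θ|·|ϖ|^d = |ϖ|` + the dyadic square
root ★ `exists_mul_self_eq_of_valued_sub_one_lt_four`); THEOREM LINE under its stub name.  v6 RESHAPE (binder only, assembler's call on LH4-p02's 20:42:51Z question (α)): the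
completeness binder `[CompleteSpace K] [Fintype 𝓀[K]]` of v1–v5 is RE-BOUND to `[IsAdicComplete 𝓂[K] 𝒪[K]]` — the binder of the whole ★ wild-quadratic layer (`WildQuadraticNorm*`, the
desk row's own source `normLadder_exists_conductor`) and of Hensel's lemma; every CM consumer has it by ★ `isAdicComplete_valuedMaximalIdeal_valuedInteger_adicCompletion`; the
mathematical content (datum, hypothesis, conclusion) is byte-identical. [cite: Serre1979, Ch. V §3 Cor. 3] -/
theorem stub_U0_normSurj_oneUnits_wild :
    ∀ {K : Type} [Field K] [Valued K ℤᵐ⁰] [IsAdicComplete 𝓂[K] 𝒪[K]] (σ : K →+* K) (ϖ : K) (d t : ℕ), IsRamifiedQuadraticDatum σ ϖ d t →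
      ∀ u : K, σ u = u → Valued.v (u - 1) ≤ Valued.v ϖ ^ (2 * d) →
        ∃ z : K, z * σ z = u ∧ Valued.v (z - 1) * Valued.v ϖ ^ d ≤ Valued.v (u - 1) * Valued.v ϖ :=
  fun σ ϖ d t hD u hσu hu => Literature.NumberTheory.LocalFields.WildQuadraticDatum.exists_mul_map_eq_of_isRamifiedQuadraticDatum σ ϖ d t hD u hσu hu

/-- **`stub_U0_valency_typeZero_wild` — `q + 1` NEIGHBOURS AT A SELF-DUAL VERTEX.**  At a complete ramified quadratic datum with finite residue field, every type-0 vertex of the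
lattice graph of `(K³, Φ₃)` has exactly `|𝓀[K]| + 1` neighbours (the residual conic of ★ R2b degenerates at `|2| < 1` to the double line `x₁² = 0`: `q + 1` points).
CENSUS-SHAPED (engine: `q + 1` at both types).  PAID at tier 2 by ★ p854714 `ncard_neighborSet_of_isSelfDualLattice_of_isRamifiedQuadraticDatum` (LH4-p02 (g12)), token for token
(`[Finite 𝓀[K]]` from `[Fintype 𝓀[K]]`; `[CompleteSpace K]` idle); THEOREM LINE under its stub name. [cite: Tits1979, §2.7 (p. 48); §2.10 (p. 49)] [cite: BruhatTits1972, §10] -/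
theorem stub_U0_valency_typeZero_wild :
    ∀ {K : Type} [Field K] [Valued K ℤᵐ⁰] [CompleteSpace K] [Fintype 𝓀[K]] (σ : K →+* K) (ϖ : K) (d t : ℕ), IsRamifiedQuadraticDatum σ ϖ d t →
      ∀ v : {M : Submodule 𝒪[K] (Fin 3 → K) // IsVertex σ ϖ ((StdForm.antidiagonal 3).over K) M},
        IsVertexLattice σ ϖ ((StdForm.antidiagonal 3).over K) 0 v.1 →
          ((latticeGraph σ ϖ ((StdForm.antidiagonal 3).over K)).neighborSet v).ncard = Nat.card 𝓀[K] + 1 :=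
  fun σ ϖ d t hD v hv => ncard_neighborSet_of_isSelfDualLattice_of_isRamifiedQuadraticDatum σ ϖ d t hD v hv

/-- **`stub_U0_valency_typeTwo_wild` — `q + 1` NEIGHBOURS AT A TYPE-TWO VERTEX** (the residual projective line of ★ R3 at the wild datum; `[K₁ : K₀ ⊓ K₁] = q + 1`).
CENSUS-SHAPED.  PAID at tier 2 by ★ p854683 `ncard_neighborSet_of_isVertexLattice_two_of_isRamifiedQuadraticDatum` (LH4-p02 (g12)), token for token (its `[Finite 𝓀[K]]` from
`[Fintype 𝓀[K]]`; `[CompleteSpace K]` idle); THEOREM LINE under its stub name. [cite: Tits1979, §2.7 (p. 48); §2.10 (p. 49)] [cite: BruhatTits1972, §10] -/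
theorem stub_U0_valency_typeTwo_wild :
    ∀ {K : Type} [Field K] [Valued K ℤᵐ⁰] [CompleteSpace K] [Fintype 𝓀[K]] (σ : K →+* K) (ϖ : K) (d t : ℕ), IsRamifiedQuadraticDatum σ ϖ d t →
      ∀ v : {M : Submodule 𝒪[K] (Fin 3 → K) // IsVertex σ ϖ ((StdForm.antidiagonal 3).over K) M},
        IsVertexLattice σ ϖ ((StdForm.antidiagonal 3).over K) 2 v.1 →
          ((latticeGraph σ ϖ ((StdForm.antidiagonal 3).over K)).neighborSet v).ncard = Nat.card 𝓀[K] + 1 :=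
  fun σ ϖ d t hD v hv => ncard_neighborSet_of_isVertexLattice_two_of_isRamifiedQuadraticDatum σ ϖ d t hD v hv

/-- **`stub_U0_dOfPlace_eq` — THE INTRINSIC DIFFERENT NUMBER OF ★ №3 IS THE DATUM'S `d`** at a ramified non-split CM place: `IsRamifiedQuadraticDatum σ_w ϖ d t →
dOfPlace L v w = d` (the set `{n > 0 | ∃ x ∈ 𝒪_w, |x − σ_w x| = exp(−n)}` is `{d + 2k}` — ★ p854647 `v_map_sub_self_le_pow_of_even` gives `n ≥ d`, `x = ϖ` gives `n = d`).
Dealer WORD #10 (1)(d); LEAD T17-34 (b6).  PAID at tier 2 by ★ p854662 `F0P3cDyRamDOfPlaceOfDatum.dOfPlace_eq_of_isRamifiedQuadraticDatum` (LH4-p02 (g12)), token for token;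
THEOREM LINE under its stub name (the `he` binder is now used). [cite: Serre1979, Ch. III §6 Prop. 13] -/
theorem stub_U0_dOfPlace_eq :
    ∀ (L : Type) [Field L] [NumberField L] [IsCMField L] {v : IsDedekindDomain.HeightOneSpectrum (NumberField.RingOfIntegers ↥(NumberField.maximalRealSubfield L))}
      (w : UnitaryGroup.PlacesOver L v) (hw : IsCMField.complexConj L • w.1 = w.1) (he : v.asIdeal.ramificationIdx' w.1.asIdeal ≠ 1)
      {ϖ : w.1.adicCompletion L} {d t : ℕ},
      IsRamifiedQuadraticDatum (galAdicCompletionMap (L := L) (IsCMField.complexConj L) hw) ϖ d t → F0P3cDyRamFourFramePieces.dOfPlace L v w = d :=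
  fun L _ _ _ _ w hw he _ _ _ hD => F0P3cDyRamDOfPlaceOfDatum.dOfPlace_eq_of_isRamifiedQuadraticDatum L w hw he hD

/-- **`stub_U0_iwahoriIndex_wild` — THE LOCAL INDEX `(q+1, q+1)` OF THE WILD TREE**: `[K₀ : K₀ ⊓ K₁] = q + 1` and `[K₁ : K₀ ⊓ K₁] = q + 1` for `K₀ = U ∩ GL₃(𝒪)`,
`K₁ = U ∩ g₁GL₃(𝒪)g₁⁻¹`, `g₁ = diag(1,1,ϖ)` — the conclusion of ★ `index_inf_subgroupOf_eq_of_ramified` TOKEN FOR TOKEN (desk row `levelIndex`, the Iwahori part; deeper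
congruence masses are U2G's).  `glInt` is the `ValuativeRel` spelling, hence the two instance binders.  PAID at tier 2 by ★ p854731
`index_inf_subgroupOf_eq_of_isRamifiedQuadraticDatum` (this seat: ★ `…LevelIndices` §3 re-lettered at the wild datum — orbit = star on both sides over ★ p854659 ∕ ★ p854568, counts
★ p854714 ∕ ★ p854683); THEOREM LINE under its stub name (`[CompleteSpace K] [Fintype 𝓀[K]]` idle but kept: `[Finite 𝓀[K]]` suffices). [cite: Tits1979, §2.7 (p. 48)] [cite: Kottwitz1988, §2] -/
theorem stub_U0_iwahoriIndex_wild :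
    ∀ {K : Type} [Field K] [Valued K ℤᵐ⁰] [ValuativeRel K] [(Valued.v : Valuation K ℤᵐ⁰).Compatible] [CompleteSpace K] [Fintype 𝓀[K]]
      (σ : K →+* K) (ϖ : K) (d t : ℕ), IsRamifiedQuadraticDatum σ ϖ d t →
      ∀ (g₁ : GL (Fin 3) K), (g₁ : Matrix (Fin 3) (Fin 3) K) = Matrix.diagonal ![(1 : K), 1, ϖ] →
        (((glInt 3 K).subgroupOf (unitaryGroupOfForm σ ((StdForm.antidiagonal 3).over K)) ⊓
            ((glInt 3 K).map (MulAut.conj g₁).toMonoidHom).subgroupOf (unitaryGroupOfForm σ ((StdForm.antidiagonal 3).over K))).subgroupOf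
              ((glInt 3 K).subgroupOf (unitaryGroupOfForm σ ((StdForm.antidiagonal 3).over K)))).index = Nat.card 𝓀[K] + 1 ∧
          (((glInt 3 K).subgroupOf (unitaryGroupOfForm σ ((StdForm.antidiagonal 3).over K)) ⊓
            ((glInt 3 K).map (MulAut.conj g₁).toMonoidHom).subgroupOf (unitaryGroupOfForm σ ((StdForm.antidiagonal 3).over K))).subgroupOf
              (((glInt 3 K).map (MulAut.conj g₁).toMonoidHom).subgroupOf (unitaryGroupOfForm σ ((StdForm.antidiagonal 3).over K)))).index = Nat.card 𝓀[K] + 1 :=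
  fun σ ϖ d t hD g₁ hg₁ => index_inf_subgroupOf_eq_of_isRamifiedQuadraticDatum σ ϖ d t hD g₁ hg₁

/-- **`stub_U0_fixedSet_subtree` — KOTTWITZ'S EULER RELATION ON THE WILD TREE ((K-1)(c): the fixed set of `γ` is a finite SUBTREE, so `n₀ + n₂ = e + 1`)**:
`#Fix_γ(U∕K₀) + #Fix_γ(U∕K₁) = #Fix_γ(U∕(K₀ ⊓ K₁)) + 1` for `γ ∈ U(σ, Φ₃)` with finitely many fixed cosets and a finite `⟨γ⟩`-orbit — the conclusion of ★
`natCard_fixedBy_add_eq_natCard_fixedBy_inf_add_one_three_of_neg` TOKEN FOR TOKEN at the wild datum.  PAID at tier 2 by ★ p854681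
`fixedSet_subtree_of_isRamifiedQuadraticDatum` (this seat: the ★ proof re-lettered with htr₀-WILD ★ p854568, htr₂-WILD ★ p854569 and the wild flags ★ p854659); THEOREM LINE under
its stub name. [cite: Kottwitz1988, §2 Theorem 2] [cite: Serre1980Trees, I.6.1; II.1.1] -/
theorem stub_U0_fixedSet_subtree :
    ∀ {K : Type} [Field K] [Valued K ℤᵐ⁰] [ValuativeRel K] [(Valued.v : Valuation K ℤᵐ⁰).Compatible] [CompleteSpace K] [Fintype 𝓀[K]]
      (σ : K →+* K) (ϖ : K) (d t : ℕ), IsRamifiedQuadraticDatum σ ϖ d t →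
      ∀ (g₁ : GL (Fin 3) K), (g₁ : Matrix (Fin 3) (Fin 3) K) = Matrix.diagonal ![(1 : K), 1, ϖ] →
      ∀ (γ : ↥(unitaryGroupOfForm σ ((StdForm.antidiagonal 3).over K))),
        (MulAction.fixedBy (↥(unitaryGroupOfForm σ ((StdForm.antidiagonal 3).over K)) ⧸
          (glInt 3 K).subgroupOf (unitaryGroupOfForm σ ((StdForm.antidiagonal 3).over K))) γ).Finite →
        (MulAction.fixedBy (↥(unitaryGroupOfForm σ ((StdForm.antidiagonal 3).over K)) ⧸
          ((glInt 3 K).map (MulAut.conj g₁).toMonoidHom).subgroupOf (unitaryGroupOfForm σ ((StdForm.antidiagonal 3).over K))) γ).Finite →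
        (Set.range fun n : ℕ => ((γ ^ n : ↥(unitaryGroupOfForm σ ((StdForm.antidiagonal 3).over K))) :
          ↥(unitaryGroupOfForm σ ((StdForm.antidiagonal 3).over K)) ⧸ (glInt 3 K).subgroupOf (unitaryGroupOfForm σ ((StdForm.antidiagonal 3).over K)))).Finite →
        Nat.card (MulAction.fixedBy (↥(unitaryGroupOfForm σ ((StdForm.antidiagonal 3).over K)) ⧸
            (glInt 3 K).subgroupOf (unitaryGroupOfForm σ ((StdForm.antidiagonal 3).over K))) γ) +
          Nat.card (MulAction.fixedBy (↥(unitaryGroupOfForm σ ((StdForm.antidiagonal 3).over K)) ⧸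
            ((glInt 3 K).map (MulAut.conj g₁).toMonoidHom).subgroupOf (unitaryGroupOfForm σ ((StdForm.antidiagonal 3).over K))) γ) =
          Nat.card (MulAction.fixedBy (↥(unitaryGroupOfForm σ ((StdForm.antidiagonal 3).over K)) ⧸
            ((glInt 3 K).subgroupOf (unitaryGroupOfForm σ ((StdForm.antidiagonal 3).over K)) ⊓
              ((glInt 3 K).map (MulAut.conj g₁).toMonoidHom).subgroupOf (unitaryGroupOfForm σ ((StdForm.antidiagonal 3).over K)))) γ) + 1 :=
  fixedSet_subtree_of_isRamifiedQuadraticDatum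

/-- **`stub_U0_period_relation_wild` — KOTTWITZ'S NON-ELLIPTIC (PERIOD) RELATION ON THE WILD TREE**: for the split torus element `τ = diag(ϖ⁻¹, 1, σϖ)` commuting with a diagonal
`γ = diag(e)` (`|e₀| = |ϖ^c|`, `|e₁| = 1`, `|e₂| = |ϖ^{−c}|`), the `⟨τ⟩`-periods of the `γ`-fixed cosets satisfy `#(Fix∕τ^ℤ)(U∕C_A) + #(U∕C_B) = #(U∕C_I)` — the conclusion of ★
`natCard_quotient_fixedBy_add_eq_natCard_quotient_fixedBy_inf_three_of_neg` TOKEN FOR TOKEN at the wild datum (any model group `G ≃* U(σ, Φ₃)` with level-membership statements).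
PAID at tier 2 by ★ p854692 `period_relation_of_isRamifiedQuadraticDatum` (this seat); THEOREM LINE under its stub name. [cite: Kottwitz1988, §2 Theorem 2]
[cite: Serre1980Trees, I.6.4 Prop. 24–25; II.1.1] -/
theorem stub_U0_period_relation_wild :
    ∀ {K : Type} [Field K] [Valued K ℤᵐ⁰] [ValuativeRel K] [(Valued.v : Valuation K ℤᵐ⁰).Compatible] [CompleteSpace K] [Fintype 𝓀[K]]
      (σ : K →+* K) (ϖ : K) (d t : ℕ), IsRamifiedQuadraticDatum σ ϖ d t →
      ∀ (g₁ : GL (Fin 3) K), (g₁ : Matrix (Fin 3) (Fin 3) K) = Matrix.diagonal ![(1 : K), 1, ϖ] →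
      ∀ {G : Type} [Group G] (eU : G ≃* ↥(unitaryGroupOfForm σ ((StdForm.antidiagonal 3).over K))) (CA CB CI : Subgroup G),
        (∀ g : G, g ∈ CA ↔ ((eU g : ↥(unitaryGroupOfForm σ ((StdForm.antidiagonal 3).over K))) : GL (Fin 3) K) ∈ glInt 3 K) →
        (∀ g : G, g ∈ CB ↔ ((eU g : ↥(unitaryGroupOfForm σ ((StdForm.antidiagonal 3).over K))) : GL (Fin 3) K) ∈ (glInt 3 K).map (MulAut.conj g₁).toMonoidHom) →
        (∀ g : G, g ∈ CI ↔ ((eU g : ↥(unitaryGroupOfForm σ ((StdForm.antidiagonal 3).over K))) : GL (Fin 3) K) ∈ glInt 3 K ∧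
          ((eU g : ↥(unitaryGroupOfForm σ ((StdForm.antidiagonal 3).over K))) : GL (Fin 3) K) ∈ (glInt 3 K).map (MulAut.conj g₁).toMonoidHom) →
      ∀ (τ γ : G), (((eU τ : ↥(unitaryGroupOfForm σ ((StdForm.antidiagonal 3).over K))) : GL (Fin 3) K) : Matrix (Fin 3) (Fin 3) K) = Matrix.diagonal ![ϖ⁻¹, 1, σ ϖ] →
      ∀ {e : Fin 3 → K}, (((eU γ : ↥(unitaryGroupOfForm σ ((StdForm.antidiagonal 3).over K))) : GL (Fin 3) K) : Matrix (Fin 3) (Fin 3) K) = Matrix.diagonal e →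
      ∀ {c : ℤ}, Valued.v (e 0) = Valued.v (ϖ ^ c) → Valued.v (e 1) = 1 → Valued.v (e 2) = Valued.v (ϖ ^ (-c)) →
      ∀ (hτγ : τ * γ = γ * τ),
        Finite (Quotient ((orbitRel (Subgroup.zpowers (⟨τ, Subgroup.mem_centralizer_singleton_iff.2 hτγ⟩ : Subgroup.centralizer ({γ} : Set G))) (G ⧸ CA)).comap
          (Subtype.val : ↥(fixedBy (G ⧸ CA) γ) → G ⧸ CA))) →
        Finite (Quotient ((orbitRel (Subgroup.zpowers (⟨τ, Subgroup.mem_centralizer_singleton_iff.2 hτγ⟩ : Subgroup.centralizer ({γ} : Set G))) (G ⧸ CB)).comap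
          (Subtype.val : ↥(fixedBy (G ⧸ CB) γ) → G ⧸ CB))) →
        Nat.card (Quotient ((orbitRel (Subgroup.zpowers (⟨τ, Subgroup.mem_centralizer_singleton_iff.2 hτγ⟩ : Subgroup.centralizer ({γ} : Set G))) (G ⧸ CA)).comap
            (Subtype.val : ↥(fixedBy (G ⧸ CA) γ) → G ⧸ CA))) +
          Nat.card (Quotient ((orbitRel (Subgroup.zpowers (⟨τ, Subgroup.mem_centralizer_singleton_iff.2 hτγ⟩ : Subgroup.centralizer ({γ} : Set G))) (G ⧸ CB)).comap
            (Subtype.val : ↥(fixedBy (G ⧸ CB) γ) → G ⧸ CB))) =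
          Nat.card (Quotient ((orbitRel (Subgroup.zpowers (⟨τ, Subgroup.mem_centralizer_singleton_iff.2 hτγ⟩ : Subgroup.centralizer ({γ} : Set G))) (G ⧸ CI)).comap
            (Subtype.val : ↥(fixedBy (G ⧸ CI) γ) → G ⧸ CI))) :=
  period_relation_of_isRamifiedQuadraticDatum

/-! ## §2  In-module assembly: the spheres of the wild tree from the two valency stubs and §0's tree -/

/-- **THE SPHERES OF THE WILD TREE — `#{y | dist(r, y) = m} = (q + 1)·q^{m−1}`** for every vertex `r` and `m ≥ 1` (desk row `stub_U0_sphere_card_wild`, here an ASSEMBLY: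
§0's `isTree_of_isRamifiedQuadraticDatum` + `stub_U0_valency_typeZero_wild` + `stub_U0_valency_typeTwo_wild` into ★ `TreeDisplacement.ncard_sphere_eq_of_biregular'` with the constant
valency vector `(q, q)`, exactly as ★ `ncard_sphere_of_ramified`; SORRY-FREE since v5 — both valency lines are ★, axioms TRIO). [cite: Serre1980Trees, I.2.3] [cite: Tits1979, §2.7 (p. 48)] -/
theorem sphere_card_wild {K : Type} [Field K] [Valued K ℤᵐ⁰] [CompleteSpace K] [Fintype 𝓀[K]] (σ : K →+* K) (ϖ : K) (d t : ℕ) (hD : IsRamifiedQuadraticDatum σ ϖ d t)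
    (r : {M : Submodule 𝒪[K] (Fin 3 → K) // IsVertex σ ϖ ((StdForm.antidiagonal 3).over K) M}) {m : ℕ} (hm : 1 ≤ m) :
    {y | (latticeGraph σ ϖ ((StdForm.antidiagonal 3).over K)).dist r y = m}.ncard = (Nat.card 𝓀[K] + 1) * Nat.card 𝓀[K] ^ (m - 1) := by
  have hvσ : ∀ a, Valued.v (σ a) = Valued.v a := hD.2.1
  have hϖ : Valued.v ϖ = WithZero.exp (-1 : ℤ) := hD.2.2.1
  have hT := isTree_of_isRamifiedQuadraticDatum hD
  obtain ⟨c, hc0⟩ := exists_typeFun (K := K) (σ := σ) (ϖ := ϖ)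
  have hdeg : ∀ v : {M : Submodule 𝒪[K] (Fin 3 → K) // IsVertex σ ϖ ((StdForm.antidiagonal 3).over K) M},
      ((latticeGraph σ ϖ ((StdForm.antidiagonal 3).over K)).neighborSet v).ncard = (![Nat.card 𝓀[K], Nat.card 𝓀[K]] : Fin 2 → ℕ) (c v) + 1 := by
    intro v
    have hq : (![Nat.card 𝓀[K], Nat.card 𝓀[K]] : Fin 2 → ℕ) (c v) = Nat.card 𝓀[K] := by
      rcases Fin.exists_fin_two.1 ⟨c v, rfl⟩ with h | h <;> rw [h] <;> rfl
    rw [hq]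
    by_cases hv : IsSelfDualLattice σ ϖ ((StdForm.antidiagonal 3).over K) v.1
    · exact stub_U0_valency_typeZero_wild σ ϖ d t hD v hv
    · exact stub_U0_valency_typeTwo_wild σ ϖ d t hD v (isVertexLattice_two_of_not_isSelfDualLattice_of_v hvσ hϖ v hv)
  have hfin : ∀ v : {M : Submodule 𝒪[K] (Fin 3 → K) // IsVertex σ ϖ ((StdForm.antidiagonal 3).over K) M},
      ((latticeGraph σ ϖ ((StdForm.antidiagonal 3).over K)).neighborSet v).Finite := fun v =>
    Set.finite_of_ncard_ne_zero (by rw [hdeg v]; exact Nat.succ_ne_zero _)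
  have hab : c r ≠ c r + 1 := by rcases Fin.exists_fin_two.1 ⟨c r, rfl⟩ with h | h <;> rw [h] <;> decide
  have h := Literature.Combinatorics.SimpleGraph.TreeDisplacement.ncard_sphere_eq_of_biregular' hT hfin r c (typeFun_ne_of_adj_of_v hvσ hϖ hc0)
    ![Nat.card 𝓀[K], Nat.card 𝓀[K]] hdeg rfl hab hm
  have hq : ∀ i : Fin 2, (![Nat.card 𝓀[K], Nat.card 𝓀[K]] : Fin 2 → ℕ) i = Nat.card 𝓀[K] := fun i => by
    rcases Fin.exists_fin_two.1 ⟨i, rfl⟩ with h | h <;> rw [h] <;> rfl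
  rw [h, hq, hq, mul_assoc, ← pow_add, show m / 2 + (m - 1) / 2 = m - 1 by omega]

end Summit.HodgeConjecture.HodgeConjecture.Cruxes.H413.F0P3cDyRamFourFrameU0

end
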